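import Mathlib
import Literature.Analysis.FluidPDE.VectorCalculus
import Literature.Analysis.FluidPDE.VectorCalculusProofs
import Literature.Analysis.FluidPDE.VorticityCalculus
import Literature.Analysis.FluidPDE.WholeSpaceIBP
import HarnessLib

/-!
# `AffineBernoulli.AlignedStratumTrivial` — pointwise kinematics of the aligned stratum
  (route `AffineBernoulli`, item stmt-NavierStokesRegularity-13663, helper file I)

Throughout `W : ℝ³ → ℝ³` is `C²`, `V y = ½(y − c) + W y` is the similarity field and `Ω = curl W`
the vorticity; the ALIGNED STRATUM is the hypothesis `Ω(y) × V(y) = 0` for all `y`.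

* `AlignedStratum.curl_eq_zero_of_simField_eq_zero` — **zero-set lemma**: at a zero `p` of `V` the
  vorticity vanishes. Differentiating `Ω × V ≡ 0` at `p` gives `Ω(p) × DV(p)x = 0` for every `x`,
  while `Ω(p)` is the curl read off the Jacobian `DV(p) = ½·id + DW(p)`; `|Ω(p)|²` is a linear
  combination of the nine scalar equations, hence `0`.
* `AlignedStratum.eq_smul_of_cross_eq_zero` — off the zero set, `Ω = λ V` with
  `λ = ⟪Ω, V⟫/‖V‖²`.
* `AlignedStratum.divergence_simField` — `div V = 3/2`;
  `AlignedStratum.fderiv_ratio_apply_simField` — the **transport law** `Dλ(y)[V y] = −(3/2) λ(y)`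
  on `{V ≠ 0}` (from `div Ω = 0`, `div V = 3/2`).

No flow, no profile equation and no decay is used here: these are facts about a `C²`
divergence-free field whose curl is everywhere parallel to `½(y − c) + W`.

HONEST FRAMING: kinematic lemmas about HYPOTHETICAL self-similar Euler profiles; nothing here bears on
the regularity problem itself.
-/

noncomputable section

set_option linter.dupNamespace false

namespace Summit.NavierStokesRegularity.NavierStokesRegularity.Theorems

open Set Function Filter Topology InnerProductSpace WithLp
open scoped RealInnerProductSpace
open Literature.Analysis.FluidPDE

namespace AlignedStratum

/-! ### Algebra of the cross product in coordinates -/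

/-- The three coordinates of `a × b = 0`. -/
theorem cross_eq_zero_iff (a b : EuclideanSpace ℝ (Fin 3)) :
    cross a b = 0 ↔
      a 1 * b 2 - a 2 * b 1 = 0 ∧ a 2 * b 0 - a 0 * b 2 = 0 ∧ a 0 * b 1 - a 1 * b 0 = 0 := by
  constructor
  · intro h
    have h0 := congrArg (fun z : EuclideanSpace ℝ (Fin 3) => z 0) h
    have h1 := congrArg (fun z : EuclideanSpace ℝ (Fin 3) => z 1) h
    have h2 := congrArg (fun z : EuclideanSpace ℝ (Fin 3) => z 2) h
    simp [cross, cross_apply] at h0 h1 h2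
    exact ⟨h0, h1, h2⟩
  · rintro ⟨h0, h1, h2⟩
    ext i
    fin_cases i <;> simp [cross, cross_apply, h0, h1, h2]

/-- **Alignment is a scalar multiple.** If `a × b = 0` and `b ≠ 0` then
`a = (⟪a, b⟫ / ‖b‖²) • b`. -/
theorem eq_smul_of_cross_eq_zero {a b : EuclideanSpace ℝ (Fin 3)} (h : cross a b = 0) (hb : b ≠ 0) :
    a = (⟪a, b⟫ / ‖b‖ ^ 2) • b := by
  obtain ⟨h0, h1, h2⟩ := (cross_eq_zero_iff a b).1 h
  have hn : ‖b‖ ^ 2 = b 0 * b 0 + b 1 * b 1 + b 2 * b 2 := by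
    rw [EuclideanSpace.real_norm_sq_eq, Fin.sum_univ_three]; ring
  have hi : ⟪a, b⟫ = a 0 * b 0 + a 1 * b 1 + a 2 * b 2 := by
    simp [PiLp.inner_apply, Fin.sum_univ_three, mul_comm]
  have hpos : 0 < ‖b‖ ^ 2 := by positivity
  ext i
  rw [PiLp.smul_apply, smul_eq_mul, div_mul_eq_mul_div, eq_div_iff hpos.ne', hn, hi]
  fin_cases i
  · simp; linear_combination b 1 * h2 - b 2 * h1
  · simp; linear_combination b 2 * h0 - b 0 * h2
  · simp; linear_combination b 0 * h1 - b 1 * h0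

/-- **Algebraic core of the zero-set lemma.** If `curl W p × (t x + DW(p) x) = 0` for every `x`
(so in particular for the three basis vectors), then `curl W p = 0`: the squared norm of the curl is
a linear combination of three of the nine alignment equations. -/
theorem curl_eq_zero_of_cross_fderiv {W : EuclideanSpace ℝ (Fin 3) → EuclideanSpace ℝ (Fin 3)} {p : EuclideanSpace ℝ (Fin 3)} (t : ℝ)
    (h : ∀ x : EuclideanSpace ℝ (Fin 3), cross (curl W p) (t • x + fderiv ℝ W p x) = 0) : curl W p = 0 := by
  set ω := curl W p with hω
  set a : Fin 3 → EuclideanSpace ℝ (Fin 3) := fun j => t • EuclideanSpace.single j 1 + fderiv ℝ W p (EuclideanSpace.single j 1)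
    with ha
  obtain ⟨c0, c1, c2⟩ :
      ω 0 = fderiv ℝ W p (EuclideanSpace.single 1 1) 2 - fderiv ℝ W p (EuclideanSpace.single 2 1) 1 ∧
      ω 1 = fderiv ℝ W p (EuclideanSpace.single 2 1) 0 - fderiv ℝ W p (EuclideanSpace.single 0 1) 2 ∧
      ω 2 = fderiv ℝ W p (EuclideanSpace.single 0 1) 1 - fderiv ℝ W p (EuclideanSpace.single 1 1) 0 := by
    simp [hω, curl]
  -- the Jacobian entries off the diagonal are those of `a`
  have ha' : ∀ j i : Fin 3, j ≠ i → fderiv ℝ W p (EuclideanSpace.single j 1) i = a j i := by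
    intro j i hji
    simp [ha, hji.symm]
  rw [ha' 1 2 (by decide), ha' 2 1 (by decide)] at c0
  rw [ha' 2 0 (by decide), ha' 0 2 (by decide)] at c1
  rw [ha' 0 1 (by decide), ha' 1 0 (by decide)] at c2
  obtain ⟨e00, -, -⟩ := (cross_eq_zero_iff ω (a 0)).1 (h _)
  obtain ⟨-, e11, -⟩ := (cross_eq_zero_iff ω (a 1)).1 (h _)
  obtain ⟨-, -, e22⟩ := (cross_eq_zero_iff ω (a 2)).1 (h _)
  have hsq : ω 0 * ω 0 + ω 1 * ω 1 + ω 2 * ω 2 = 0 := by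
    linear_combination ω 0 * c0 + ω 1 * c1 + ω 2 * c2 - e11 - e22 - e00
  have h0 : ω 0 = 0 := by nlinarith [mul_self_nonneg (ω 0), mul_self_nonneg (ω 1), mul_self_nonneg (ω 2)]
  have h1 : ω 1 = 0 := by nlinarith [mul_self_nonneg (ω 0), mul_self_nonneg (ω 1), mul_self_nonneg (ω 2)]
  have h2 : ω 2 = 0 := by nlinarith [mul_self_nonneg (ω 0), mul_self_nonneg (ω 1), mul_self_nonneg (ω 2)]
  ext i
  fin_cases i
  · simpa using h0
  · simpa using h1
  · simpa using h2

/-! ### The similarity field `V y = ½(y − c) + W y` -/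

/-- Derivative of the similarity field: `DV(y) = ½·id + DW(y)`. -/
theorem hasFDerivAt_simField {W : EuclideanSpace ℝ (Fin 3) → EuclideanSpace ℝ (Fin 3)} {c : EuclideanSpace ℝ (Fin 3)} (hW : Differentiable ℝ W) (y : EuclideanSpace ℝ (Fin 3)) :
    HasFDerivAt (fun y => (1 / 2 : ℝ) • (y - c) + W y)
      ((1 / 2 : ℝ) • ContinuousLinearMap.id ℝ (EuclideanSpace ℝ (Fin 3)) + fderiv ℝ W y) y := by
  have h1 : HasFDerivAt (fun y : EuclideanSpace ℝ (Fin 3) => (1 / 2 : ℝ) • (y - c))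
      ((1 / 2 : ℝ) • ContinuousLinearMap.id ℝ (EuclideanSpace ℝ (Fin 3))) y :=
    ((hasFDerivAt_id y).sub_const c).const_smul (1 / 2 : ℝ)
  exact h1.add (hW y).hasFDerivAt

/-- The similarity field is `Cⁿ` when `W` is. -/
theorem contDiff_simField {W : EuclideanSpace ℝ (Fin 3) → EuclideanSpace ℝ (Fin 3)} {c : EuclideanSpace ℝ (Fin 3)} {n : WithTop ℕ∞} (hW : ContDiff ℝ n W) :
    ContDiff ℝ n (fun y => (1 / 2 : ℝ) • (y - c) + W y) :=
  ((contDiff_id.sub contDiff_const).const_smul _).add hW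

/-- **`div V = 3/2`** for the similarity field of a divergence-free `W`. -/
theorem divergence_simField {W : EuclideanSpace ℝ (Fin 3) → EuclideanSpace ℝ (Fin 3)} {c : EuclideanSpace ℝ (Fin 3)} (hW : Differentiable ℝ W)
    (hdiv : VectorCalculus.IsDivFree W) (y : EuclideanSpace ℝ (Fin 3)) :
    VectorCalculus.divergence (fun y => (1 / 2 : ℝ) • (y - c) + W y) y = 3 / 2 := by
  have hD := (hasFDerivAt_simField (c := c) hW y).fderiv
  have h0 := hdiv y
  rw [divergence_eq_sum_inner_fderiv (EuclideanSpace.basisFun (Fin 3) ℝ)] at h0 ⊢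
  rw [hD]
  simp only [_root_.add_apply, _root_.FunLike.coe_smul, Pi.smul_apply,
    ContinuousLinearMap.coe_id', id_eq, inner_add_right, inner_smul_right, Finset.sum_add_distrib,
    ← Finset.mul_sum] at h0 ⊢
  rw [h0]
  simp
  norm_num

/-! ### The zero-set lemma -/

/-- **Zero-set lemma.** Let `W ∈ C²` and suppose the vorticity is everywhere aligned with the
similarity field, `curl W y × (½(y−c) + W y) = 0` for all `y`. Then at every zero `p` of
`½(y−c) + W y` the vorticity vanishes: `curl W p = 0`.
Proof: the map `y ↦ curl W y × V y` is identically zero, so its derivative at `p` vanishes; by the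
product rule and `V p = 0` this derivative is `x ↦ curl W p × DV(p) x` with `DV(p) = ½ id + DW(p)`,
and `curl_eq_zero_of_cross_fderiv` concludes. -/
theorem curl_eq_zero_of_simField_eq_zero {W : EuclideanSpace ℝ (Fin 3) → EuclideanSpace ℝ (Fin 3)} {c p : EuclideanSpace ℝ (Fin 3)} (hW : ContDiff ℝ 2 W)
    (halign : ∀ y, cross (curl W y) ((1 / 2 : ℝ) • (y - c) + W y) = 0)
    (hp : (1 / 2 : ℝ) • (p - c) + W p = 0) : curl W p = 0 := by
  have hWd : Differentiable ℝ W := hW.differentiable (by norm_num)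
  have hΩ1 : ContDiff ℝ 1 (curl W) := contDiff_curl (n := 1) (by exact_mod_cast hW)
  have hΩd : DifferentiableAt ℝ (curl W) p := (hΩ1.differentiable one_ne_zero) p
  have hV := hasFDerivAt_simField (c := c) hWd p
  have hprod := hasFDerivAt_cross hΩd.hasFDerivAt hV
  -- the product is identically zero, so its derivative vanishes
  have hzero : HasFDerivAt (fun y => cross (curl W y) ((1 / 2 : ℝ) • (y - c) + W y))
      (0 : EuclideanSpace ℝ (Fin 3) →L[ℝ] EuclideanSpace ℝ (Fin 3)) p := by
    have : (fun y => cross (curl W y) ((1 / 2 : ℝ) • (y - c) + W y)) = fun _ => (0 : EuclideanSpace ℝ (Fin 3)) :=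
      funext halign
    rw [this]
    exact hasFDerivAt_const 0 p
  have hL := hprod.unique hzero
  refine curl_eq_zero_of_cross_fderiv (1 / 2 : ℝ) fun x => ?_
  have hx := congrArg (fun L : EuclideanSpace ℝ (Fin 3) →L[ℝ] EuclideanSpace ℝ (Fin 3) => L x) hL
  simp only [_root_.add_apply, ContinuousLinearMap.precompR_apply,
    ContinuousLinearMap.precompL_apply, crossCLM_apply, _root_.zero_apply] at hx
  have h0 : cross ((fderiv ℝ (curl W) p) x) (0 : EuclideanSpace ℝ (Fin 3)) = 0 :=
    (cross_eq_zero_iff _ _).2 (by simp)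
  rw [hp, h0, add_zero] at hx
  exact hx

/-! ### The transport law for `λ = ⟪Ω, V⟫ / ‖V‖²` -/

/-- Off the zero set of the similarity field, an aligned vorticity is the multiple
`curl W y = λ(y) • V(y)` with `λ = ⟪curl W, V⟫/‖V‖²`. -/
theorem curl_eq_ratio_smul {W : EuclideanSpace ℝ (Fin 3) → EuclideanSpace ℝ (Fin 3)} {c y : EuclideanSpace ℝ (Fin 3)}
    (halign : cross (curl W y) ((1 / 2 : ℝ) • (y - c) + W y) = 0)
    (hy : (1 / 2 : ℝ) • (y - c) + W y ≠ 0) :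
    curl W y = (⟪curl W y, (1 / 2 : ℝ) • (y - c) + W y⟫ / ‖(1 / 2 : ℝ) • (y - c) + W y‖ ^ 2) •
      ((1 / 2 : ℝ) • (y - c) + W y) :=
  eq_smul_of_cross_eq_zero halign hy

/-- The ratio `λ y = ⟪curl W y, V y⟫/‖V y‖²` is `C¹` at every point where `V y ≠ 0` (`W ∈ C²`). -/
theorem contDiffAt_ratio {W : EuclideanSpace ℝ (Fin 3) → EuclideanSpace ℝ (Fin 3)} {c y : EuclideanSpace ℝ (Fin 3)} (hW : ContDiff ℝ 2 W)
    (hy : (1 / 2 : ℝ) • (y - c) + W y ≠ 0) :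
    ContDiffAt ℝ 1 (fun z => ⟪curl W z, (1 / 2 : ℝ) • (z - c) + W z⟫ /
      ‖(1 / 2 : ℝ) • (z - c) + W z‖ ^ 2) y := by
  have hΩ1 : ContDiff ℝ 1 (curl W) := contDiff_curl (n := 1) (by exact_mod_cast hW)
  have hV1 : ContDiff ℝ 1 (fun z => (1 / 2 : ℝ) • (z - c) + W z) :=
    contDiff_simField (hW.of_le (by norm_num))
  refine ContDiffAt.div (hΩ1.contDiffAt.inner ℝ hV1.contDiffAt) ?_ (by positivity)
  exact (hV1.contDiffAt.norm ℝ hy).pow 2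

/-- **Transport law.** For `W ∈ C²` divergence free with aligned vorticity, the ratio
`λ = ⟪curl W, V⟫/‖V‖²` satisfies `Dλ(y)[V y] = −(3/2) λ(y)` at every `y` with `V y ≠ 0`
(`0 = div (curl W) = div (λ V) = Dλ[V] + (3/2) λ` near `y`). -/
theorem fderiv_ratio_apply_simField {W : EuclideanSpace ℝ (Fin 3) → EuclideanSpace ℝ (Fin 3)} {c y : EuclideanSpace ℝ (Fin 3)} (hW : ContDiff ℝ 2 W)
    (hdiv : VectorCalculus.IsDivFree W)
    (halign : ∀ z, cross (curl W z) ((1 / 2 : ℝ) • (z - c) + W z) = 0)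
    (hy : (1 / 2 : ℝ) • (y - c) + W y ≠ 0) :
    fderiv ℝ (fun z => ⟪curl W z, (1 / 2 : ℝ) • (z - c) + W z⟫ / ‖(1 / 2 : ℝ) • (z - c) + W z‖ ^ 2) y
        ((1 / 2 : ℝ) • (y - c) + W y) =
      -(3 / 2) * (⟪curl W y, (1 / 2 : ℝ) • (y - c) + W y⟫ / ‖(1 / 2 : ℝ) • (y - c) + W y‖ ^ 2) := by
  set V : EuclideanSpace ℝ (Fin 3) → EuclideanSpace ℝ (Fin 3) := fun z => (1 / 2 : ℝ) • (z - c) + W z with hVdef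
  set lam : EuclideanSpace ℝ (Fin 3) → ℝ := fun z => ⟪curl W z, V z⟫ / ‖V z‖ ^ 2 with hlam
  have hWd : Differentiable ℝ W := hW.differentiable (by norm_num)
  have hVc : Continuous V := (contDiff_simField (c := c) (hW.of_le (by norm_num) : ContDiff ℝ 0 W)).continuous
  -- `V ≠ 0` on a neighbourhood of `y`, where `curl W = lam • V`
  have hne : ∀ᶠ z in 𝓝 y, V z ≠ 0 := (hVc.continuousAt).eventually_ne hy
  have heq : (fun z => lam z • V z) =ᶠ[𝓝 y] curl W := by
    filter_upwards [hne] with z hz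
    exact (curl_eq_ratio_smul (halign z) hz).symm
  -- hence the two divergences agree at `y`
  have hdivΩ : VectorCalculus.divergence (curl W) y = 0 := divergence_curl_eq_zero_holds W hW y
  have hdiv1 : VectorCalculus.divergence (fun z => lam z • V z) y = 0 := by
    unfold VectorCalculus.divergence
    rw [heq.fderiv_eq]
    exact hdivΩ
  have hlamd : DifferentiableAt ℝ lam y := (contDiffAt_ratio (c := c) hW hy).differentiableAt one_ne_zero
  have hVd : DifferentiableAt ℝ V y := (hasFDerivAt_simField (c := c) hWd y).differentiableAt
  rw [divergence_smul_apply hlamd hVd, divergence_simField hWd hdiv y] at hdiv1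
  have hgrad : ⟪V y, gradient lam y⟫ = fderiv ℝ lam y (V y) := by
    rw [real_inner_comm, gradient, InnerProductSpace.toDual_symm_apply]
  rw [hgrad] at hdiv1
  show fderiv ℝ lam y (V y) = -(3 / 2) * lam y
  linarith

end AlignedStratum

end Summit.NavierStokesRegularity.NavierStokesRegularity.Theorems
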